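import Literature.Computability.AlgebraicComplexity.NoncommutativeCircuits
import HarnessLib

/-!
# Small noncommutative circuits for the Cayley determinant give small noncommutative circuits for
# the Cayley permanent (Arvind–Srinivasan 2010, §4, Theorem 10 / `thm_cayley_ckt`)

Topic: `Literature/Computability/AlgebraicComplexity`. Statement file: ONE named fact (held text
`paper:arxiv-0910.2370`, §4):

> We consider polynomials over an arbitrary field `F` … **Theorem 10.** For any `n ∈ ℕ`, if there is a
> circuit `C` of size `s` computing `Cdet_{2n}(X)`, then there is a circuit `C'` of size polynomial in
> `s` and `n` that computes `Cperm_n(Y)`.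

("circuit" = noncommutative arithmetic circuit, §2: fan-in two, each product gate with a designated
left and right child; `Cdet_n = ∑_σ sgn(σ) x_{1,σ(1)} ⋯ x_{n,σ(n)}`, `Cperm_n` likewise without signs,
§1.) The proof (§3–4) composes the given circuit with a polynomial-size ABP through the
noncommutative Hadamard product (Cor. `hadcor1`) and substitutes. Companion results NOT rendered here:
Thm 11 (a polynomial-time algorithm for `Cdet_{2n}` over `M_{cn²}(F)` gives one for the `n × n`
permanent over `F`), the Moore-determinant and symmetrized versions (§5–6); Chien–Harsha–Sinclair–
Srinivasan (STOC 2011) and Bläser (ICALP 2013) strengthen the algebra side to `M_2(F)` / all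
division-free noncommutative algebras.

Rendering, in the tree's circuit model (`NoncommutativeCircuits.lean`: fan-in-two `ArithCircuit`
read in the free algebra, size = number of gates, COLUMN-ordered `ncDetPoly` / `ncPerPoly` — AS10's
row-ordered `Cdet`, `Cperm` up to the size-preserving renaming `x_{ij} ↦ x_{ji}` applied to hypothesis
and conclusion alike; "size polynomial in `s` and `n`" as one exponent `e`, size `≤ (s + n + 2)^e`, which
also absorbs the constant factor between AS10's node count and the tree's gate count):
`∃ e, ∀ n s, HasNcCircuitSizeLE (ncDetPoly F (2n)) s → HasNcCircuitSizeLE (ncPerPoly F n) ((s+n+2)^e)`.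
Statement only (named fact; no discharge attempted). No instances, no notation.

USE. Summit-side (`Summits/ValiantsHypothesis/…/Theorems/NcDeterminantFace.lean`): with this fact,
"the Cayley determinant has no polynomial-size noncommutative circuits" is a NECESSARY condition for
`VP ≠ VNP` (through the dial piece `A_nc` for the permanent), although commutatively `det ∈ VP`.

## References

* [ArvindSrinivasan2010] V. Arvind, S. Srinivasan, *On the hardness of the noncommutative
  determinant*, STOC 2010, 677–686 (arXiv:0910.2370; Comput. Complexity 27 (2018)), §1, §2, §4
  Thm 10 (`thm_cayley_ckt`), Thm 11.
-/

noncomputable section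

namespace Literature.Computability.AlgebraicComplexity

universe u

/-- **Arvind–Srinivasan 2010, §4 Theorem 10** ("if there is a circuit `C` of size `s` computing
`Cdet_{2n}(X)`, then there is a circuit `C'` of size polynomial in `s` and `n` that computes
`Cperm_n(Y)`"), over an arbitrary field `F`, in the tree's noncommutative circuit model with one
polynomial exponent `e` (module docstring). Named fact, used as a hypothesis.
[cite: ArvindSrinivasan2010, §4 Thm 10 (thm_cayley_ckt)] [status: theorem in print, not formalised] -/
def AS10_thm_10 (F : Type u) [Field F] : Prop :=
  ∃ e : ℕ, ∀ n s : ℕ, HasNcCircuitSizeLE (ncDetPoly F (2 * n)) s →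
    HasNcCircuitSizeLE (ncPerPoly F n) ((s + n + 2) ^ e)

end Literature.Computability.AlgebraicComplexity

end
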